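import Summits.Ventures.PercRepro.SixFourT3B

/-!
# PercRepro — C-025 at `(6,4)`, PROPOSITION 21.9 IN THE KERNEL: the `g = 10` cell at `t = 3` (p3, gen 8)

mine-2's `MINE2-RLS.md` §21.9, PROPOSITION 21.9: in the cell `Cell10` (a rank-`4` set of `10` points of a simple
matroid whose plane traces have `≤ 5` and whose line traces `≤ 4` points) the hard max-trace balance at `t = 3`
satisfies `J₃ ≥ 153.6 = 768/5 > 0`.  With parts A–B this file proves the last ingredient and assembles the bound:

* the «line + point minimum» for the two trace sizes: a rank-`3` set with `4` points has at least `3` independent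
  triples (at most one collinear triple: two of them would share two points, hence a line, hence the whole set;
  `three_le_card_indepTriples_of_card_four`), one with `5` points at least `6` (at most `4` collinear triples: if some
  `4`-subset is collinear every collinear triple lies in it; otherwise collinear triples pairwise share `≤ 1` point
  and their `3` pairs each are disjoint inside the `10` pairs; `six_le_card_indepTriples_of_card_five`);
* the independent triples of `G` are partitioned by the plane they span, so `3·a₄ + 6·a₅ ≤ C(10,3) = 120`
  (`three_a4_add_six_a5_le`);
* THEOREM `J_three_ge_of_cell10`: `768/5 ≤ J M G 3` — mine-2's computation
  `J₃ ≥ 1089.6 + (3/5)d₄ − (9/5)a₅ − 9a₄ − 45a₅ ≥ 1089.6 − max(9a₄ + 46.8a₅) = 153.6` from `I₄ + d₄ = 210`,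
  `N₄ + d₄ + e₅ = 848`, `DF₃ ≥ 56`, `pp + 2lpp ≤ 6a₄ + 30a₅`, `e₅ ≤ a₅`, `3a₄ + 6a₅ ≤ 120` (`linarith`), and its
  corollary `J_three_pos_of_cell10`.
-/

namespace PercRepro.SixFour

open Finset ThmH

variable {α : Type*} [DecidableEq α] {M : Matroid α} [M.Finite] {G : Finset α}

/-! ## Independent and collinear triples of a point set -/

/-- The independent triples of `ρ` (rank `3`). -/
noncomputable def indepTriples (M : Matroid α) [M.Finite] (ρ : Finset α) : Finset (Finset α) :=
  (ρ.powersetCard 3).filter (fun T : Finset α => M.eRk (T : Set α) = 3)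

/-- The collinear (dependent) triples of `ρ`: the `3`-subsets of rank `≠ 3`. -/
noncomputable def depTriples (M : Matroid α) [M.Finite] (ρ : Finset α) : Finset (Finset α) :=
  ρ.powersetCard 3 \ indepTriples M ρ

omit [DecidableEq α] in
/-- Membership in `indepTriples`. -/
theorem mem_indepTriples {ρ T : Finset α} : T ∈ indepTriples M ρ ↔ T ⊆ ρ ∧ T.card = 3 ∧ M.eRk (T : Set α) = 3 := by
  unfold indepTriples
  rw [Finset.mem_filter, Finset.mem_powersetCard, and_assoc]

/-- Membership in `depTriples`. -/
theorem mem_depTriples {ρ T : Finset α} : T ∈ depTriples M ρ ↔ T ⊆ ρ ∧ T.card = 3 ∧ ¬ M.eRk (T : Set α) = 3 := by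
  unfold depTriples
  rw [Finset.mem_sdiff, mem_indepTriples, Finset.mem_powersetCard]
  tauto

/-- `#indep + #dep = C(|ρ|, 3)`. -/
theorem card_indepTriples_add_card_depTriples (ρ : Finset α) :
    (indepTriples M ρ).card + (depTriples M ρ).card = ρ.card.choose 3 := by
  unfold depTriples
  have hsub : indepTriples M ρ ⊆ ρ.powersetCard 3 := Finset.filter_subset _ _
  rw [add_comm, Finset.card_sdiff_add_card_eq_card hsub, Finset.card_powersetCard]

/-- A collinear triple has rank exactly `2`, so its closure is a line containing it. -/
theorem clF_mem_lines_of_mem_depTriples (hs : Simple M) {ρ T : Finset α} (hρ : ρ ⊆ gr M)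
    (hT : T ∈ depTriples M ρ) : M.eRk (T : Set α) = 2 ∧ clF M T ∈ lines M ∧ T ⊆ clF M T := by
  obtain ⟨hTρ, hc, hr⟩ := mem_depTriples.1 hT
  have hle : M.eRk (T : Set α) ≤ 3 := by
    have := M.eRk_le_encard (T : Set α)
    rw [Set.encard_coe_eq_coe_finsetCard, hc] at this
    exact this
  obtain ⟨a, ha, b, hb, hab⟩ := Finset.one_lt_card.1 (by omega : 1 < T.card)
  have h2 := two_le_eRk_of_two_mem hs (hTρ.trans hρ) ha hb hab
  have hr2 : M.eRk (T : Set α) = 2 := by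
    obtain ⟨k, hk, -⟩ := eRk_eq_nat M T
    rw [hk] at hle hr h2 ⊢
    have h1 : k ≤ 3 := by exact_mod_cast hle
    have h3 : k ≠ 3 := fun h3 => hr (by rw [h3]; rfl)
    have h4 : 2 ≤ k := by exact_mod_cast h2
    have : k = 2 := by omega
    rw [this]
    rfl
  obtain ⟨hL, hTL⟩ := clF_mem_lines (hTρ.trans hρ) hr2
  exact ⟨hr2, hL, hTL⟩

/-- Two distinct collinear triples of a rank-`3` set share at most one point. -/
theorem card_inter_le_one_of_depTriples (hs : Simple M) {ρ T₁ T₂ : Finset α} (hρ : ρ ⊆ gr M)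
    (h₁ : T₁ ∈ depTriples M ρ) (h₂ : T₂ ∈ depTriples M ρ) (hne : T₁ ≠ T₂)
    (hQ : ∀ Q ⊆ ρ, Q.card = 4 → ¬ M.eRk (Q : Set α) ≤ 2) : (T₁ ∩ T₂).card ≤ 1 := by
  by_contra hlt
  obtain ⟨a, ha, b, hb, hab⟩ := Finset.one_lt_card.1 (by omega : 1 < (T₁ ∩ T₂).card)
  obtain ⟨-, hL₁, hTL₁⟩ := clF_mem_lines_of_mem_depTriples hs hρ h₁
  obtain ⟨-, hL₂, hTL₂⟩ := clF_mem_lines_of_mem_depTriples hs hρ h₂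
  obtain ⟨hT₁ρ, hc₁, -⟩ := mem_depTriples.1 h₁
  obtain ⟨hT₂ρ, hc₂, -⟩ := mem_depTriples.1 h₂
  have hL : clF M T₁ = clF M T₂ :=
    lines_eq_of_two_mem hs hL₁ hL₂ (hTL₁ (Finset.mem_inter.1 ha).1) (hTL₁ (Finset.mem_inter.1 hb).1)
      (hTL₂ (Finset.mem_inter.1 ha).2) (hTL₂ (Finset.mem_inter.1 hb).2) hab
  -- `T₁ ∪ T₂` has at least `4` points and lies on the line
  have hcard : 4 ≤ (T₁ ∪ T₂).card := by
    have h := Finset.card_union_add_card_inter T₁ T₂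
    have hint : (T₁ ∩ T₂).card ≤ 2 := by
      by_contra h3
      have h3' : T₁.card ≤ (T₁ ∩ T₂).card := by omega
      have := Finset.eq_of_subset_of_card_le Finset.inter_subset_left h3'
      have h12 : T₁ ⊆ T₂ := by rw [← this]; exact Finset.inter_subset_right
      exact hne (Finset.eq_of_subset_of_card_le h12 (by omega))
    omega
  obtain ⟨Q, hQsub, hQc⟩ := Finset.exists_subset_card_eq hcard
  refine hQ Q (hQsub.trans (Finset.union_subset hT₁ρ hT₂ρ)) hQc ?_
  have hQL : Q ⊆ clF M T₁ := by
    intro x hx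
    rcases Finset.mem_union.1 (hQsub hx) with hx₁ | hx₂
    · exact hTL₁ hx₁
    · rw [hL]; exact hTL₂ hx₂
  rw [← (mem_lines.1 hL₁).2.2]
  exact M.eRk_mono (Finset.coe_subset.2 hQL)

/-- A rank-`3` set with `4` points has at least `3` independent triples. -/
theorem three_le_card_indepTriples_of_card_four (hs : Simple M) {ρ : Finset α} (hρ : ρ ⊆ gr M)
    (hc : ρ.card = 4) (hr : M.eRk (ρ : Set α) = 3) : 3 ≤ (indepTriples M ρ).card := by
  have hsum := card_indepTriples_add_card_depTriples (M := M) ρ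
  rw [hc, show Nat.choose 4 3 = 4 from rfl] at hsum
  have hdep : (depTriples M ρ).card ≤ 1 := by
    rw [Finset.card_le_one]
    intro T₁ h₁ T₂ h₂
    by_contra hne
    have hQ : ∀ Q ⊆ ρ, Q.card = 4 → ¬ M.eRk (Q : Set α) ≤ 2 := by
      intro Q hQρ hQc h2
      have hQ : Q = ρ := Finset.eq_of_subset_of_card_le hQρ (by omega)
      rw [hQ, hr] at h2
      exact absurd h2 (by decide)
    have h1 := card_inter_le_one_of_depTriples hs hρ h₁ h₂ hne hQ
    obtain ⟨hT₁ρ, hc₁, -⟩ := mem_depTriples.1 h₁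
    obtain ⟨hT₂ρ, hc₂, -⟩ := mem_depTriples.1 h₂
    have h := Finset.card_union_add_card_inter T₁ T₂
    have hu : (T₁ ∪ T₂).card ≤ 4 := by
      rw [← hc]
      exact Finset.card_le_card (Finset.union_subset hT₁ρ hT₂ρ)
    omega
  omega

/-- A rank-`3` set with `5` points has at least `6` independent triples. -/
theorem six_le_card_indepTriples_of_card_five (hs : Simple M) {ρ : Finset α} (hρ : ρ ⊆ gr M)
    (hc : ρ.card = 5) (hr : M.eRk (ρ : Set α) = 3) : 6 ≤ (indepTriples M ρ).card := by
  have hsum := card_indepTriples_add_card_depTriples (M := M) ρ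
  rw [hc, show Nat.choose 5 3 = 10 from rfl] at hsum
  have hdep : (depTriples M ρ).card ≤ 4 := by
    by_cases hQ : ∃ Q ⊆ ρ, Q.card = 4 ∧ M.eRk (Q : Set α) ≤ 2
    · -- a collinear `4`-subset `Q`: every collinear triple lies in `Q`
      obtain ⟨Q, hQρ, hQc, hQr⟩ := hQ
      have hQr2 : M.eRk (Q : Set α) = 2 := by
        obtain ⟨a, ha, b, hb, hab⟩ := Finset.one_lt_card.1 (by omega : 1 < Q.card)
        exact le_antisymm hQr (two_le_eRk_of_two_mem hs (hQρ.trans hρ) ha hb hab)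
      obtain ⟨hLQ, hQL⟩ := clF_mem_lines (hQρ.trans hρ) hQr2
      have hsub : depTriples M ρ ⊆ Q.powersetCard 3 := by
        intro T hT
        obtain ⟨-, hL, hTL⟩ := clF_mem_lines_of_mem_depTriples hs hρ hT
        obtain ⟨hTρ, hTc, -⟩ := mem_depTriples.1 hT
        rw [Finset.mem_powersetCard]
        refine ⟨?_, hTc⟩
        by_contra hTQ
        obtain ⟨a, haT, haQ⟩ := Finset.not_subset.1 hTQ
        -- `T ∩ Q` has at least two points (`ρ ∖ Q` is a single point)
        have hTQc : 2 ≤ (T ∩ Q).card := by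
          have h1 : (T \ Q).card ≤ (ρ \ Q).card := Finset.card_le_card (Finset.sdiff_subset_sdiff hTρ le_rfl)
          have h2 : (ρ \ Q).card = 1 := by rw [Finset.card_sdiff_of_subset hQρ, hc, hQc]
          have h3 := Finset.card_sdiff_add_card_inter T Q
          omega
        obtain ⟨y, hy, z, hz, hyz⟩ := Finset.one_lt_card.1 (by omega : 1 < (T ∩ Q).card)
        have hLeq : clF M T = clF M Q :=
          lines_eq_of_two_mem hs hL hLQ (hTL (Finset.mem_inter.1 hy).1) (hTL (Finset.mem_inter.1 hz).1)
            (hQL (Finset.mem_inter.1 hy).2) (hQL (Finset.mem_inter.1 hz).2) hyz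
        -- then `ρ = Q ∪ {a} ⊆ cl(Q)`, contradicting rank `3`
        have hρeq : insert a Q = ρ :=
          Finset.eq_of_subset_of_card_le (Finset.insert_subset (hTρ haT) hQρ)
            (by rw [Finset.card_insert_of_notMem haQ]; omega)
        have hρL : ρ ⊆ clF M Q := by
          rw [← hρeq]
          exact Finset.insert_subset (by rw [← hLeq]; exact hTL haT) hQL
        have := M.eRk_mono (Finset.coe_subset.2 hρL)
        rw [hr, (mem_lines.1 hLQ).2.2] at this
        exact absurd this (by decide)
      calc (depTriples M ρ).card ≤ (Q.powersetCard 3).card := Finset.card_le_card hsub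
        _ = 4 := by rw [Finset.card_powersetCard, hQc]; rfl
    · -- no collinear `4`-subset: collinear triples pairwise share `≤ 1` point; count their pairs
      push Not at hQ
      have hQ' : ∀ Q ⊆ ρ, Q.card = 4 → ¬ M.eRk (Q : Set α) ≤ 2 := fun Q hQρ hQc => by
        have := hQ Q hQρ hQc
        exact not_le.2 this
      have hdisj : ((depTriples M ρ : Finset (Finset α)) : Set (Finset α)).PairwiseDisjoint
          (fun T : Finset α => T.powersetCard 2) := by
        intro T₁ h₁ T₂ h₂ hne
        rw [Function.onFun, Finset.disjoint_left]
        intro p hp₁ hp₂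
        rw [Finset.mem_powersetCard] at hp₁ hp₂
        have h1 := card_inter_le_one_of_depTriples hs hρ (Finset.mem_coe.1 h₁) (Finset.mem_coe.1 h₂) hne hQ'
        have hpsub : p ⊆ T₁ ∩ T₂ := Finset.subset_inter hp₁.1 hp₂.1
        have := Finset.card_le_card hpsub
        omega
      have hcount : ((depTriples M ρ).biUnion (fun T : Finset α => T.powersetCard 2)).card =
          3 * (depTriples M ρ).card := by
        rw [Finset.card_biUnion hdisj]
        rw [Finset.sum_congr rfl (fun T hT => by
          rw [Finset.card_powersetCard, (mem_depTriples.1 hT).2.1] : ∀ T ∈ depTriples M ρ,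
            (T.powersetCard 2).card = Nat.choose 3 2)]
        rw [Finset.sum_const, smul_eq_mul, show Nat.choose 3 2 = 3 from rfl, mul_comm]
      have hle : ((depTriples M ρ).biUnion (fun T : Finset α => T.powersetCard 2)).card ≤
          (ρ.powersetCard 2).card := by
        refine Finset.card_le_card ?_
        intro p hp
        obtain ⟨T, hT, hpT⟩ := Finset.mem_biUnion.1 hp
        rw [Finset.mem_powersetCard] at hpT ⊢
        exact ⟨hpT.1.trans (mem_depTriples.1 hT).1, hpT.2⟩
      rw [Finset.card_powersetCard, hc] at hle
      have : Nat.choose 5 2 = 10 := rfl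
      omega
  omega

/-! ## `3·a₄ + 6·a₅ ≤ C(10, 3)`: the independent triples of `G` are partitioned by the plane they span -/

/-- The independent triples inside a rank-`3` trace `P ∩ G` lie in the fibre of `P`. -/
theorem indepTriples_trace_subset_fiber {P : Finset α} (hP : P ∈ planes M) :
    indepTriples M (P ∩ G) ⊆ (indepTriples M G).filter (fun T : Finset α => clF M T = P) := by
  intro T hT
  obtain ⟨hTPG, hc, hr⟩ := mem_indepTriples.1 hT
  rw [Finset.mem_filter, mem_indepTriples]
  refine ⟨⟨hTPG.trans Finset.inter_subset_right, hc, hr⟩, ?_⟩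
  apply Finset.coe_injective
  rw [coe_clF]
  exact closure_eq_of_subset_plane hP (hTPG.trans Finset.inter_subset_left) hr

/-- The fibre of a plane `P` contains at least `3·[P ∈ a₄] + 6·[P ∈ a₅]` independent triples. -/
theorem fiber_card_ge (hs : Simple M) (h : Cell10 M G) {P : Finset α} (hP : P ∈ planes M) :
    (if P ∈ planesTrace M G 4 then 3 else 0) + (if P ∈ planesTrace M G 5 then 6 else 0) ≤
      ((indepTriples M G).filter (fun T : Finset α => clF M T = P)).card := by
  have hsub := Finset.card_le_card (indepTriples_trace_subset_fiber (M := M) (G := G) hP)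
  have hPG : P ∩ G ⊆ gr M := Finset.inter_subset_right.trans h.subset
  by_cases h4 : P ∈ planesTrace M G 4
  · obtain ⟨-, hc, hr⟩ := mem_planesTrace.1 h4
    have h5 : P ∉ planesTrace M G 5 := fun h5 => by
      have := (mem_planesTrace.1 h5).2.1
      omega
    rw [if_pos h4, if_neg h5]
    have := three_le_card_indepTriples_of_card_four hs hPG hc hr
    omega
  · rw [if_neg h4]
    by_cases h5 : P ∈ planesTrace M G 5
    · obtain ⟨-, hc, hr⟩ := mem_planesTrace.1 h5
      rw [if_pos h5]
      have := six_le_card_indepTriples_of_card_five hs hPG hc hr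
      omega
    · rw [if_neg h5]
      exact Nat.zero_le _

/-- `3·a₄ + 6·a₅ ≤ 120`. -/
theorem three_a4_add_six_a5_le (hs : Simple M) (h : Cell10 M G) : 3 * a4 M G + 6 * a5 M G ≤ 120 := by
  have hmaps : ∀ T ∈ indepTriples M G, clF M T ∈ planes M := by
    intro T hT
    obtain ⟨hTG, -, hr⟩ := mem_indepTriples.1 hT
    exact (clF_mem_planes (hTG.trans h.subset) hr).1
  have htot : (indepTriples M G).card ≤ 120 := by
    unfold indepTriples
    calc ((G.powersetCard 3).filter (fun T : Finset α => M.eRk (T : Set α) = 3)).card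
        ≤ (G.powersetCard 3).card := Finset.card_filter_le _ _
      _ = 120 := by rw [Finset.card_powersetCard, h.card]; rfl
  rw [Finset.card_eq_sum_card_fiberwise hmaps] at htot
  have hsum : ∑ P ∈ planes M, ((if P ∈ planesTrace M G 4 then 3 else 0) + (if P ∈ planesTrace M G 5 then 6 else 0)) ≤
      ∑ P ∈ planes M, ((indepTriples M G).filter (fun T : Finset α => clF M T = P)).card :=
    Finset.sum_le_sum (fun P hP => fiber_card_ge hs h hP)
  rw [Finset.sum_add_distrib, ← Finset.sum_filter, ← Finset.sum_filter, Finset.sum_const, Finset.sum_const,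
    smul_eq_mul, smul_eq_mul, Finset.filter_mem_eq_inter, Finset.filter_mem_eq_inter,
    Finset.inter_eq_right.2 (planesTrace_subset 4), Finset.inter_eq_right.2 (planesTrace_subset 5)] at hsum
  unfold a4 a5
  omega

/-! ## PROPOSITION 21.9 -/

/-- **Proposition 21.9** (mine-2 §21.9): in the cell «`g = 10`, planes `≤ 5`, lines `≤ 4`» of a simple matroid the
hard max-trace balance at `t = 3` is at least `153.6 = 768/5`. -/
theorem J_three_ge_of_cell10 (hs : Simple M) (h : Cell10 M G) : (768 / 5 : ℚ) ≤ J M G 3 := by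
  rw [J_three_eq hs h.subset]
  have h1 : (I4 M G : ℚ) + d4 M G = 210 := by exact_mod_cast I4_add_d4 h
  have h2 : (N4 M G : ℚ) + d4 M G + e5 M G = 848 := by exact_mod_cast N4_add_d4_add_e5 hs h
  have h3 : (56 : ℚ) ≤ DF M G 3 := by exact_mod_cast df_three_ge hs h
  have h4 : (pp M G : ℚ) + 2 * lpp M G ≤ 6 * a4 M G + 30 * a5 M G := by exact_mod_cast pp_add_two_lpp_le hs h
  have h5 : (e5 M G : ℚ) ≤ a5 M G := by exact_mod_cast e5_le_a5 hs h
  have h6 : 3 * (a4 M G : ℚ) + 6 * a5 M G ≤ 120 := by exact_mod_cast three_a4_add_six_a5_le hs h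
  have h7 : (0 : ℚ) ≤ lpp M G := Nat.cast_nonneg _
  have h8 : (0 : ℚ) ≤ d4 M G := Nat.cast_nonneg _
  have h9 : (0 : ℚ) ≤ a5 M G := Nat.cast_nonneg _
  linarith

/-- `(J₃^∞)` holds in the cell: `0 < J₃`. -/
theorem J_three_pos_of_cell10 (hs : Simple M) (h : Cell10 M G) : 0 < J M G 3 :=
  lt_of_lt_of_le (by norm_num) (J_three_ge_of_cell10 hs h)

end PercRepro.SixFour
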